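import Summits.RiemannHypothesis.RiemannHypothesis.Theorems.SignConeExactConeRigidityCaratheodory
import Summits.RiemannHypothesis.RiemannHypothesis.Theorems.SignConeExactConeRigidityDirichlet

/-!
# Route SignCone, item `ExactConeRigidity` (stmt-RiemannHypothesis-16306): the Carathéodory description of
cone weights in Dirichlet-series form (archive 2001 fefr Thm A / A♭)

`SignConeExactConeRigidityCaratheodory.lean` proves `0 ≤ Re ∫₀^∞ a(x) e^{-zx} dx` (`Re z > 0`) for the
translate function `a(x) = (W_ar - P_c)(G(· - x)) + κ G(-x)` of a `κ`-slack cone weight `c ≥ 0` (`G = g ⋆ g̃`).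
Here the Laplace integral is evaluated on `Re z > 1/2` (`s = z + 1/2`, `Re s > 1`, where `D_c(s) = Σ c(n) n^{-s}`
converges, `LSeriesSummable_of_unitSlack`): with `M_G = weilMellin G`,

  `∫₀^∞ a e^{-zx} = M_G(0)/s + 𝓐_G(z) - (D_c(s) M_G(s) - M_G(1)/(s-1) + Fin_c(z)) + κ 𝓖(z)`,

`𝓐_G(z) = ∫₀^∞ W_∞(G(· - x)) e^{-zx} dx` (archimedean part), `𝓖(z) = ∫₀^∞ G(-x) e^{-zx} dx`, `Fin_c` the finite
boundary correction of `SignCone.LSeries_mul_weilMellin_sub_pole_eq` (nodes `n ≤ e^{2a}`). Hence the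
**Carathéodory description** (`re_LSeries_mul_weilMellin_le`):

  `Re (D_c(s) M_G(s)) ≤ Re (M_G(0)/s + M_G(1)/(s-1) + 𝓐_G(s - 1/2) + κ 𝓖(s - 1/2) - Fin_c(s - 1/2))`, `Re s > 1`,

for every window test `g`; specialised to the exact cone (`κ = 0`, this item: `re_LSeries_mul_weilMellin_le_exact`)
and to the unit-slack cone (`κ = 1`, `ConeMagnification`: `re_LSeries_mul_weilMellin_le_unitSlack`). On
`1/2 < Re s ≤ 1` the same inequality holds for the analytic continuation of `D_c M_G` (the Laplace form, by the
identity theorem); it is the structural input ("`K_c ≥ 0`") of the rigidity / deficit step of the exact chain.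
-/

noncomputable section

-- `Summit.RiemannHypothesis.RiemannHypothesis.…` repeats a namespace component by design (D-0017 layout).
set_option linter.dupNamespace false

open scoped BigOperators ComplexConjugate Real Topology
open Complex MeasureTheory Set Filter Finset LSeries

namespace Summit.RiemannHypothesis.RiemannHypothesis.Theorems.SignConeExactConeRigidity

open Literature.NumberTheory.LFunctions
open Summit.RiemannHypothesis.RiemannHypothesis.Theorems.SignCone
open Summit.RiemannHypothesis.RiemannHypothesis.Theorems.RuelleBandCofiniteCriticalLine

variable {g : ℝ → ℂ} {c : ℕ → ℝ} {κ a : ℝ}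

/-- `∫₀^∞ e^{-x/2} e^{-zx} dx = 1/(z + 1/2)` for `Re z > -1/2`. -/
theorem integral_exp_neg_half_laplace {z : ℂ} (hz : -(1 / 2) < z.re) :
    ∫ x in Ioi (0 : ℝ), cexp (-((x : ℂ) / 2)) * cexp (-(z * x)) = 1 / (z + 1 / 2) := by
  have ha : ((-(1 / 2) : ℂ) - z).re < 0 := by
    simp only [sub_re, neg_re, one_div]
    norm_num
    linarith
  have h := integral_exp_mul_complex_Ioi ha 0
  have e : (fun x : ℝ => cexp (-((x : ℂ) / 2)) * cexp (-(z * x))) = fun x : ℝ => cexp ((-(1 / 2) - z) * x) := by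
    funext x
    rw [← Complex.exp_add]
    congr 1
    ring
  rw [e, h]
  simp only [ofReal_zero, mul_zero, Complex.exp_zero]
  rw [show (-(1 / 2) : ℂ) - z = -(z + 1 / 2) by ring, div_neg, neg_div, neg_neg]

/-- The archimedean part `x ↦ W_∞(K(· - x))` of a Weil test kernel is continuous in `x`. -/
theorem continuous_weilArchTerm_weilTranslate {K : ℝ → ℂ} (hK : IsWeilTest K) :
    Continuous fun x : ℝ => weilArchTerm (weilTranslate K x) := by
  have h := continuous_weilArchPolar_weilTranslate hK
  have hP : Continuous fun x : ℝ => weilPolarTerm (weilTranslate K x) := by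
    have e : (fun x : ℝ => weilPolarTerm (weilTranslate K x)) = fun x : ℝ =>
        cexp (-((x : ℂ) / 2)) * weilMellin K 0 + cexp ((x : ℂ) / 2) * weilMellin K 1 := by
      funext x; exact weilPolarTerm_weilTranslate K x
    rw [e]; fun_prop
  have e : (fun x : ℝ => weilArchTerm (weilTranslate K x)) = fun x : ℝ =>
      (weilPolarTerm (weilTranslate K x) + weilArchTerm (weilTranslate K x)) - weilPolarTerm (weilTranslate K x) := by
    funext x; ring
  rw [e]
  exact h.sub hP

/-- **Carathéodory description of cone weights, Dirichlet-series form** (archive 2001 fefr Thm A / A♭). Let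
`c ≥ 0` be `κ`-slack feasible AND unit-slack feasible against every Weil test (the second follows from the first
when `κ ≤ 1`), `g` a Weil test with `tsupport g ⊆ [-a, a]` (`a ≥ 0`), `G = g ⋆ g̃`, `M_G = weilMellin G`. Then for
`Re s > 1`:
`Re (D_c(s) M_G(s)) ≤ Re (M_G(0)/s + M_G(1)/(s-1) + 𝓐_G(s-1/2) + κ 𝓖(s-1/2) - Fin_c(s-1/2))`
with `𝓐_G(z) = ∫₀^∞ W_∞(G(·-x)) e^{-zx} dx`, `𝓖(z) = ∫₀^∞ G(-x) e^{-zx} dx` and `Fin_c` the finite correction of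
`SignCone.LSeries_mul_weilMellin_sub_pole_eq`. Proof: `0 ≤ Re ∫₀^∞ a e^{-zx}`
(`re_laplace_fakeForm_translate_nonneg`) and the evaluation of the Laplace integral of
`a(x) = e^{-x/2}M_G(0) + e^{x/2}M_G(1) + W_∞(G(·-x)) - P_c(G(·-x)) + κ G(-x)`. -/
theorem re_LSeries_mul_weilMellin_le
    (hUκ : ∀ φ : ℝ → ℂ, IsWeilTest φ →
      -(κ * ∫ t, ‖φ t‖ ^ 2) ≤
        (weilPolarTerm (weilConv φ (weilReflect φ)) + weilArchTerm (weilConv φ (weilReflect φ)) -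
          ∑' n : ℕ, ((c n : ℝ) : ℂ) / (Real.sqrt n : ℂ) *
            (weilConv φ (weilReflect φ) (Real.log n) + weilConv φ (weilReflect φ) (-Real.log n))).re)
    (hU : ∀ φ : ℝ → ℂ, IsWeilTest φ →
      -(∫ t, ‖φ t‖ ^ 2) ≤
        (weilPolarTerm (weilConv φ (weilReflect φ)) + weilArchTerm (weilConv φ (weilReflect φ)) -
          ∑' n : ℕ, ((c n : ℝ) : ℂ) / (Real.sqrt n : ℂ) *
            (weilConv φ (weilReflect φ) (Real.log n) + weilConv φ (weilReflect φ) (-Real.log n))).re)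
    (hc : ∀ n, 0 ≤ c n) (hg : IsWeilTest g) (ha : 0 ≤ a) (hsupp : tsupport g ⊆ Icc (-a) a)
    {s : ℂ} (hs : 1 < s.re) :
    (LSeries (fun n => ((c n : ℝ) : ℂ)) s * weilMellin (weilConv g (weilReflect g)) s).re ≤
      (weilMellin (weilConv g (weilReflect g)) 0 / s + weilMellin (weilConv g (weilReflect g)) 1 / (s - 1) +
        (∫ x in Ioi (0 : ℝ), weilArchTerm (weilTranslate (weilConv g (weilReflect g)) x) * cexp (-((s - 1 / 2) * x))) +
        (κ : ℂ) * (∫ x in Ioi (0 : ℝ), weilConv g (weilReflect g) (-x) * cexp (-((s - 1 / 2) * x))) -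
        ∑ n ∈ Finset.range (⌊Real.exp (2 * a)⌋₊ + 1), ((c n : ℝ) : ℂ) / (Real.sqrt n : ℂ) *
          ((∫ x in Ioi (0 : ℝ), (weilConv g (weilReflect g) (Real.log n - x) +
              weilConv g (weilReflect g) (-Real.log n - x)) * cexp (-((s - 1 / 2) * x))) -
            cexp (-((s - 1 / 2) * Real.log n)) * weilMellin (weilConv g (weilReflect g)) (s - 1 / 2 + 1 / 2))).re := by
  -- write `s = z + 1/2`
  obtain ⟨z, rfl⟩ : ∃ z : ℂ, s = z + 1 / 2 := ⟨s - 1 / 2, by ring⟩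
  have hz12 : 1 / 2 < z.re := by
    have : (z + 1 / 2).re = z.re + 1 / 2 := by simp
    rw [this] at hs
    linarith
  have hz0 : 0 < z.re := by linarith
  have e2 : z + 1 / 2 - 1 = z - 1 / 2 := by ring
  have e3 : z + 1 / 2 - 1 / 2 = z := by ring
  simp only [e2, e3]
  set G : ℝ → ℂ := weilConv g (weilReflect g) with hG
  have hGt : IsWeilTest G := hg.weilConv hg.weilReflect
  obtain ⟨M, hM⟩ := hGt.1.continuous.bounded_above_of_compact_support hGt.2
  -- the pieces of `a(x) e^{-zx}` and their integrability on `(0, ∞)`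
  set f₀ : ℝ → ℂ := fun x => cexp (-((x : ℂ) / 2)) * weilMellin G 0 * cexp (-(z * x)) with hf₀
  set fA : ℝ → ℂ := fun x => weilArchTerm (weilTranslate G x) * cexp (-(z * x)) with hfA
  set u : ℝ → ℂ := fun x => (∑' n : ℕ, ((c n : ℝ) : ℂ) / (Real.sqrt n : ℂ) *
      (G (Real.log n - x) + G (-Real.log n - x))) - cexp ((x : ℂ) / 2) * weilMellin G 1 with hu
  set fu : ℝ → ℂ := fun x => u x * cexp (-(z * x)) with hfu
  set fG : ℝ → ℂ := fun x => G (-x) * cexp (-(z * x)) with hfG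
  have hi₀ : IntegrableOn f₀ (Ioi 0) := by
    have ha' : ((-(1 / 2) : ℂ) - z).re < 0 := by
      simp only [sub_re, neg_re, one_div]; norm_num; linarith
    have h : IntegrableOn (fun x : ℝ => cexp ((-(1 / 2) - z) * x) * weilMellin G 0) (Ioi 0) :=
      (integrableOn_exp_mul_complex_Ioi ha' 0).mul_const _
    refine h.congr_fun (fun x _ => ?_) measurableSet_Ioi
    show cexp ((-(1 / 2) - z) * x) * weilMellin G 0 = cexp (-((x : ℂ) / 2)) * weilMellin G 0 * cexp (-(z * x))
    rw [show ((-(1 / 2) : ℂ) - z) * x = -((x : ℂ) / 2) + -(z * x) by ring, Complex.exp_add]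
    ring
  have hiA : IntegrableOn fA (Ioi 0) := by
    refine integrableOn_mul_exp_of_bounded (continuous_weilArchTerm_weilTranslate hGt)
      (C := 1 / (2 * π) * (∫ t : ℝ, ‖weilMellin G (1 / 2 + t * I) *
        ((Complex.digamma (1 / 4 + t / 2 * I)).re : ℂ)‖) + M * Real.log π) (fun x _ => ?_) hz0
    refine (norm_weilArchTerm_weilTranslate_le hGt x).trans (add_le_add le_rfl ?_)
    exact mul_le_mul_of_nonneg_right (hM _) (Real.log_nonneg (by linarith [Real.pi_gt_three]))
  have hiu : IntegrableOn fu (Ioi 0) :=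
    integrableOn_mul_exp_of_bounded (@continuous_fakeSum_translate_sub g a hg hsupp c)
      (fun x hx => @norm_fakeSum_translate_sub_le g c hU hg M hM x hx) hz0
  have hiG : IntegrableOn fG (Ioi 0) :=
    integrableOn_mul_exp_of_bounded (hGt.1.continuous.comp continuous_neg) (C := M) (fun x _ => hM _) hz0
  -- the pointwise decomposition of `a(x) e^{-zx}`
  have hdecomp : ∀ x : ℝ,
      (weilPolarTerm (weilTranslate G x) + weilArchTerm (weilTranslate G x) -
          (∑' n : ℕ, ((c n : ℝ) : ℂ) / (Real.sqrt n : ℂ) *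
            (weilTranslate G x (Real.log n) + weilTranslate G x (-Real.log n))) +
        (κ : ℂ) * weilTranslate G x 0) * cexp (-(z * x)) =
      f₀ x + fA x - fu x + (κ : ℂ) * fG x := by
    intro x
    simp only [hf₀, hfA, hfu, hfG, hu, weilPolarTerm_weilTranslate, weilTranslate, zero_sub]
    ring
  -- the Laplace integral of `a`, split into the four pieces
  have hL := re_laplace_fakeForm_translate_nonneg hUκ hg hz0
  have hcongr : (∫ x in Ioi (0 : ℝ),
      (weilPolarTerm (weilTranslate G x) + weilArchTerm (weilTranslate G x) -
          (∑' n : ℕ, ((c n : ℝ) : ℂ) / (Real.sqrt n : ℂ) *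
            (weilTranslate G x (Real.log n) + weilTranslate G x (-Real.log n))) +
        (κ : ℂ) * weilTranslate G x 0) * cexp (-(z * x))) =
      ∫ x in Ioi (0 : ℝ), (f₀ x + fA x - fu x + (κ : ℂ) * fG x) :=
    integral_congr_ae ((ae_restrict_iff' measurableSet_Ioi).2 (Eventually.of_forall fun x _ => hdecomp x))
  have hs1 : (∫ x in Ioi (0 : ℝ), (f₀ x + fA x - fu x + (κ : ℂ) * fG x)) =
      (∫ x in Ioi (0 : ℝ), (f₀ x + fA x - fu x)) + ∫ x in Ioi (0 : ℝ), (κ : ℂ) * fG x :=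
    integral_add ((hi₀.add hiA).sub hiu) (hiG.const_mul _)
  have hs2 : (∫ x in Ioi (0 : ℝ), (f₀ x + fA x - fu x)) =
      (∫ x in Ioi (0 : ℝ), (f₀ x + fA x)) - ∫ x in Ioi (0 : ℝ), fu x :=
    integral_sub (hi₀.add hiA) hiu
  have hs3 : (∫ x in Ioi (0 : ℝ), (f₀ x + fA x)) = (∫ x in Ioi (0 : ℝ), f₀ x) + ∫ x in Ioi (0 : ℝ), fA x :=
    integral_add hi₀ hiA
  have hs4 : (∫ x in Ioi (0 : ℝ), (κ : ℂ) * fG x) = (κ : ℂ) * ∫ x in Ioi (0 : ℝ), fG x := integral_const_mul _ _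
  -- evaluate `∫ f₀` and `∫ fu`
  have hI₀ : (∫ x in Ioi (0 : ℝ), f₀ x) = weilMellin G 0 / (z + 1 / 2) := by
    have e : f₀ = fun x : ℝ => weilMellin G 0 * (cexp (-((x : ℂ) / 2)) * cexp (-(z * x))) := by
      funext x; simp only [hf₀]; ring
    rw [e, integral_const_mul, integral_exp_neg_half_laplace (by linarith)]
    ring
  have hsum : LSeriesSummable (fun n => ((c n : ℝ) : ℂ)) ((z.re + 1 / 2 : ℝ) : ℂ) := by
    have h := LSeriesSummable_of_unitSlack hU hc (σ := z.re + 1 / 2) (by linarith)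
    simpa using h
  have hIu := LSeries_mul_weilMellin_sub_pole_eq hU hc hg ha hsupp hz12 hsum
  -- assemble: real parts
  rw [hcongr, hs1, hs2, hs3, hs4, hI₀] at hL
  have h1 := congrArg Complex.re hIu
  simp only [Complex.sub_re, Complex.add_re, Complex.re_ofReal_mul] at hL h1 ⊢
  linarith

/-- **Carathéodory description of EXACT-cone weights** (`κ = 0`; archive 2001 fefr Thm A, `Re s > 1` form): if
`c ≥ 0` is exact-feasible against every Weil test, then for every window test `g` (`G = g ⋆ g̃`) and `Re s > 1`,
`Re (D_c(s) M_G(s)) ≤ Re (M_G(0)/s + M_G(1)/(s-1) + 𝓐_G(s-1/2) - Fin_c(s-1/2))`. -/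
theorem re_LSeries_mul_weilMellin_le_exact
    (hU0 : ∀ φ : ℝ → ℂ, IsWeilTest φ →
      0 ≤ (weilPolarTerm (weilConv φ (weilReflect φ)) + weilArchTerm (weilConv φ (weilReflect φ)) -
          ∑' n : ℕ, ((c n : ℝ) : ℂ) / (Real.sqrt n : ℂ) *
            (weilConv φ (weilReflect φ) (Real.log n) + weilConv φ (weilReflect φ) (-Real.log n))).re)
    (hc : ∀ n, 0 ≤ c n) (hg : IsWeilTest g) (ha : 0 ≤ a) (hsupp : tsupport g ⊆ Icc (-a) a)
    {s : ℂ} (hs : 1 < s.re) :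
    (LSeries (fun n => ((c n : ℝ) : ℂ)) s * weilMellin (weilConv g (weilReflect g)) s).re ≤
      (weilMellin (weilConv g (weilReflect g)) 0 / s + weilMellin (weilConv g (weilReflect g)) 1 / (s - 1) +
        (∫ x in Ioi (0 : ℝ), weilArchTerm (weilTranslate (weilConv g (weilReflect g)) x) * cexp (-((s - 1 / 2) * x))) -
        ∑ n ∈ Finset.range (⌊Real.exp (2 * a)⌋₊ + 1), ((c n : ℝ) : ℂ) / (Real.sqrt n : ℂ) *
          ((∫ x in Ioi (0 : ℝ), (weilConv g (weilReflect g) (Real.log n - x) +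
              weilConv g (weilReflect g) (-Real.log n - x)) * cexp (-((s - 1 / 2) * x))) -
            cexp (-((s - 1 / 2) * Real.log n)) * weilMellin (weilConv g (weilReflect g)) (s - 1 / 2 + 1 / 2))).re := by
  have hUκ : ∀ φ : ℝ → ℂ, IsWeilTest φ →
      -((0 : ℝ) * ∫ t, ‖φ t‖ ^ 2) ≤
        (weilPolarTerm (weilConv φ (weilReflect φ)) + weilArchTerm (weilConv φ (weilReflect φ)) -
          ∑' n : ℕ, ((c n : ℝ) : ℂ) / (Real.sqrt n : ℂ) *
            (weilConv φ (weilReflect φ) (Real.log n) + weilConv φ (weilReflect φ) (-Real.log n))).re := by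
    intro φ hφ; rw [zero_mul, neg_zero]; exact hU0 φ hφ
  have hU : ∀ φ : ℝ → ℂ, IsWeilTest φ →
      -(∫ t, ‖φ t‖ ^ 2) ≤
        (weilPolarTerm (weilConv φ (weilReflect φ)) + weilArchTerm (weilConv φ (weilReflect φ)) -
          ∑' n : ℕ, ((c n : ℝ) : ℂ) / (Real.sqrt n : ℂ) *
            (weilConv φ (weilReflect φ) (Real.log n) + weilConv φ (weilReflect φ) (-Real.log n))).re := by
    intro φ hφ
    have h1 := hU0 φ hφ
    have h2 : 0 ≤ ∫ t, ‖φ t‖ ^ 2 := integral_nonneg fun t => by positivity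
    linarith
  have h := re_LSeries_mul_weilMellin_le hUκ hU hc hg ha hsupp hs
  simp only [Complex.ofReal_zero, zero_mul, add_zero] at h
  exact h

/-- **Carathéodory description of UNIT-SLACK cone weights** (`κ = 1`; archive 2001 swcm Thm A♭, `Re s > 1`
form; the weights of `ConeMagnification`, stmt-RiemannHypothesis-16303). -/
theorem re_LSeries_mul_weilMellin_le_unitSlack
    (hU : ∀ φ : ℝ → ℂ, IsWeilTest φ →
      -(∫ t, ‖φ t‖ ^ 2) ≤
        (weilPolarTerm (weilConv φ (weilReflect φ)) + weilArchTerm (weilConv φ (weilReflect φ)) -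
          ∑' n : ℕ, ((c n : ℝ) : ℂ) / (Real.sqrt n : ℂ) *
            (weilConv φ (weilReflect φ) (Real.log n) + weilConv φ (weilReflect φ) (-Real.log n))).re)
    (hc : ∀ n, 0 ≤ c n) (hg : IsWeilTest g) (ha : 0 ≤ a) (hsupp : tsupport g ⊆ Icc (-a) a)
    {s : ℂ} (hs : 1 < s.re) :
    (LSeries (fun n => ((c n : ℝ) : ℂ)) s * weilMellin (weilConv g (weilReflect g)) s).re ≤
      (weilMellin (weilConv g (weilReflect g)) 0 / s + weilMellin (weilConv g (weilReflect g)) 1 / (s - 1) +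
        (∫ x in Ioi (0 : ℝ), weilArchTerm (weilTranslate (weilConv g (weilReflect g)) x) * cexp (-((s - 1 / 2) * x))) +
        (∫ x in Ioi (0 : ℝ), weilConv g (weilReflect g) (-x) * cexp (-((s - 1 / 2) * x))) -
        ∑ n ∈ Finset.range (⌊Real.exp (2 * a)⌋₊ + 1), ((c n : ℝ) : ℂ) / (Real.sqrt n : ℂ) *
          ((∫ x in Ioi (0 : ℝ), (weilConv g (weilReflect g) (Real.log n - x) +
              weilConv g (weilReflect g) (-Real.log n - x)) * cexp (-((s - 1 / 2) * x))) -
            cexp (-((s - 1 / 2) * Real.log n)) * weilMellin (weilConv g (weilReflect g)) (s - 1 / 2 + 1 / 2))).re := by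
  have hUκ : ∀ φ : ℝ → ℂ, IsWeilTest φ →
      -((1 : ℝ) * ∫ t, ‖φ t‖ ^ 2) ≤
        (weilPolarTerm (weilConv φ (weilReflect φ)) + weilArchTerm (weilConv φ (weilReflect φ)) -
          ∑' n : ℕ, ((c n : ℝ) : ℂ) / (Real.sqrt n : ℂ) *
            (weilConv φ (weilReflect φ) (Real.log n) + weilConv φ (weilReflect φ) (-Real.log n))).re := by
    intro φ hφ; rw [one_mul]; exact hU φ hφ
  have h := re_LSeries_mul_weilMellin_le hUκ hU hc hg ha hsupp hs
  simp only [Complex.ofReal_one, one_mul] at h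
  exact h

end Summit.RiemannHypothesis.RiemannHypothesis.Theorems.SignConeExactConeRigidity
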